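import Mathlib
import HarnessLib
import Summits.ValiantsHypothesis.ValiantsHypothesis.Theses.PermanentalCones
import Literature.Combinatorics.StablePolynomials.Limits
import Literature.Combinatorics.StablePolynomials.BasicProofs

/-!
# Route PermanentalCones — support item `PermanentalHyperbolic` (the permanental witnesses are real stable)

The support item `PermanentalHyperbolic` (`stmt-ValiantsHypothesis-8658`) of route `PermanentalCones`
states: for an entrywise nonnegative real `n × n` matrix `Y` and `r : ℕ`, the permanental polynomial
`P = per[Y_{rows<r}; s; …; s] ∈ ℝ[s_1..s_n]` (the first `r` rows constant, taken from `Y`, the others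
all equal to the variable row `s`) satisfies: if `P(𝟙) ≠ 0` then every complex zero `z` of
`z ↦ P(x + z𝟙)` (`x` real) is real.

Proof (Gårding / Lieb–Sokal / Borcea–Brändén, as on the route card): `P` is **real stable**. Writing
`P_k` for the polynomial with `k` constant rows, `P_0 = n! ∏ s_j` is stable, and by row-symmetry of
the permanent and the Leibniz rule, `(n-k) P_{k+1} = Σ_j Y_{kj} ∂_j P_k` (polarisation of one variable
row in the nonnegative direction `Y_k`). The operator `Σ_j y_j ∂_j` with `y ≥ 0` maps a stable
polynomial to `0` or a stable one: `Σ_j y_j ∂_j p = ∂_t p(s + t y)|_{t=0}`, the lift `p(s + ty)` is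
stable in the `n+1` variables `(s,t)`, and `∂_t` (Gauss–Lucas; `IsUpperHalfPlaneStable.pderiv`) and
the real specialisation `t := 0` (Hurwitz; `eq_zero_or_stable_of_eval_update_zero`) preserve
"`0` or stable" — both proved in `Literature/Combinatorics/StablePolynomials`. Hence the
complexification of `P` is `0` or stable; `P(𝟙) ≠ 0` excludes `0`; real stability gives
real-rootedness along the positive line `x + z𝟙`
(`IsRealStable.im_eq_zero_of_eval₂_line_eq_zero`).

References: D. G. Wagner, *Multivariate stable polynomials*, Bull. AMS 48 (2011), Lemma 2.4;
J. Borcea, P. Brändén, Invent. Math. 177 (2009), §1–2 (Lieb–Sokal Lemma 2.1);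
L. Gurvits, arXiv:math/0510452 (the permanental polynomials as polarised derivatives of `∏ s_j`).
-/

-- `<Problem> = <Summit>` for this single-conjunct summit (lakefile sets the same option tree-wide).
set_option linter.dupNamespace false

noncomputable section

namespace Summit.ValiantsHypothesis.ValiantsHypothesis.Theorems

open MvPolynomial Finset
open scoped BigOperators
open Literature.Combinatorics.StablePolynomials

/-! ### Leibniz rule and the permanent -/

/-- Leibniz rule for a derivation `D : A → A` over a finite product:
`D(∏ fᵢ) = Σᵢ (∏_{j ≠ i} fⱼ) · D(fᵢ)`. -/
theorem derivation_finset_prod {R A ι : Type*} [CommRing R] [CommRing A] [Algebra R A]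
    [DecidableEq ι] (D : Derivation R A A) (s : Finset ι) (f : ι → A) :
    D (∏ i ∈ s, f i) = ∑ i ∈ s, (∏ j ∈ s.erase i, f j) * D (f i) := by
  induction s using Finset.induction_on with
  | empty => simp
  | insert a s ha ih =>
    rw [Finset.prod_insert ha, Derivation.leibniz, ih, Finset.sum_insert ha,
      Finset.erase_insert ha, smul_eq_mul, smul_eq_mul, Finset.mul_sum, add_comm]
    congr 1
    refine Finset.sum_congr rfl fun i hi => ?_
    have hia : i ≠ a := fun h => ha (h ▸ hi)
    rw [Finset.erase_insert_of_ne hia.symm,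
      Finset.prod_insert (fun h => ha (Finset.mem_of_mem_erase h)), mul_assoc]

/-- A ring homomorphism passes through the permanent: `f (per M) = per (f ∘ M)`. -/
theorem ringHom_map_permanent {m : Type*} [DecidableEq m] [Fintype m] {R S : Type*}
    [CommSemiring R] [CommSemiring S] (f : R →+* S) (M : Matrix m m R) :
    f M.permanent = (M.map f).permanent := by
  simp [Matrix.permanent, map_sum, map_prod]

/-- Leibniz rule for the permanent: a derivation of `per M` is the sum over the entries
`(σ b, b)` of the permutation products with that entry differentiated. -/
theorem derivation_permanent {R A : Type*} [CommRing R] [CommRing A] [Algebra R A]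
    {m : Type*} [DecidableEq m] [Fintype m] (D : Derivation R A A) (M : Matrix m m A) :
    D M.permanent =
      ∑ σ : Equiv.Perm m, ∑ b, (∏ b' ∈ univ.erase b, M (σ b') b') * D (M (σ b) b) := by
  simp only [Matrix.permanent, map_sum, derivation_finset_prod]

/-- Row expansion of the permanent of a matrix with row `a` replaced by `w`:
`per (N[a ↦ w]) = Σ_σ w_{σ⁻¹ a} ∏_{b ≠ σ⁻¹ a} N_{σ b, b}`. -/
theorem permanent_updateRow_eq_sum {m : Type*} [DecidableEq m] [Fintype m] {R : Type*}
    [CommSemiring R] (N : Matrix m m R) (a : m) (w : m → R) :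
    (N.updateRow a w).permanent =
      ∑ σ : Equiv.Perm m, w (σ.symm a) * ∏ b ∈ univ.erase (σ.symm a), N (σ b) b := by
  unfold Matrix.permanent
  refine Finset.sum_congr rfl fun σ _ => ?_
  rw [← Finset.mul_prod_erase univ _ (mem_univ (σ.symm a))]
  congr 1
  · simp
  · refine Finset.prod_congr rfl fun b hb => ?_
    have : σ b ≠ a := fun h => (Finset.ne_of_mem_erase hb) (by rw [← h, Equiv.symm_apply_apply])
    rw [Matrix.updateRow_ne this]

/-! ### The permanental polynomials `P_k = per[Y_{rows<k}; s; …; s]` and their row recursion -/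

section Rows

variable {R : Type*} [CommRing R] {n : ℕ}

/-- Swapping rows `k` and `a₀` (`a₀ ≥ k`) of the matrix with `k+1` constant rows gives the matrix
with `k` constant rows whose row `a₀` is replaced by the constant row `Y_k`. -/
theorem rowMatrix_succ_submatrix_swap (Y : Fin n → Fin n → R) {k : ℕ} (hk : k < n)
    (a₀ : Fin n) (ha₀ : k ≤ (a₀ : ℕ)) :
    (Matrix.of fun a b : Fin n =>
        if (a : ℕ) < k + 1 then C (Y a b) else (X b : MvPolynomial (Fin n) R)).submatrix
        (Equiv.swap ⟨k, hk⟩ a₀) id =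
      (Matrix.of fun a b : Fin n =>
        if (a : ℕ) < k then C (Y a b) else (X b : MvPolynomial (Fin n) R)).updateRow a₀
        (fun b => C (Y ⟨k, hk⟩ b)) := by
  ext a b
  simp only [Matrix.submatrix_apply, id, Matrix.of_apply, Matrix.updateRow_apply]
  by_cases ha : a = a₀
  · subst ha
    rw [Equiv.swap_apply_right, if_pos rfl]
    simp
  · rw [if_neg ha]
    by_cases hak : a = ⟨k, hk⟩
    · subst hak
      rw [Equiv.swap_apply_left]
      have h1 : ¬ ((a₀ : ℕ) < k + 1) := by
        intro h
        rw [Fin.ext_iff, Fin.val_mk] at ha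
        omega
      rw [if_neg h1, if_neg (lt_irrefl k)]
    · rw [Equiv.swap_apply_of_ne_of_ne hak ha]
      have hne : (a : ℕ) ≠ k := fun h => hak (Fin.ext h)
      by_cases hlt : (a : ℕ) < k
      · rw [if_pos hlt, if_pos (by omega)]
      · rw [if_neg hlt, if_neg (by omega)]

/-- **Row recursion (polarisation of one variable row).** For `k < n`,
`Σ_j Y_{kj} ∂_j per[Y_{<k}; s^{(n-k)}] = Σ_{a ≥ k} per[Y_{<k+1}; s^{(n-k-1)}]` (`n - k` equal
summands): by the Leibniz rule the left side is the sum over the variable rows `a ≥ k` of the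
permanent with row `a` replaced by `Y_k`, and each of these is `per[Y_{<k+1}; …]` after swapping
rows `a` and `k`. This is Gurvits' identity `per[Y_{<k+1}; s^{(n-k-1)}] = (n-k)⁻¹ D_{Y_k} per[Y_{<k}; s^{(n-k)}]`. -/
theorem sum_C_mul_pderiv_rowPermanent (Y : Fin n → Fin n → R) {k : ℕ} (hk : k < n) :
    (∑ j, C (Y ⟨k, hk⟩ j) * pderiv j (Matrix.of fun a b : Fin n =>
        if (a : ℕ) < k then C (Y a b) else (X b : MvPolynomial (Fin n) R)).permanent) =
      ∑ _a ∈ univ.filter (fun a : Fin n => k ≤ (a : ℕ)), (Matrix.of fun a b : Fin n =>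
        if (a : ℕ) < k + 1 then C (Y a b) else (X b : MvPolynomial (Fin n) R)).permanent := by
  set κ : Fin n := ⟨k, hk⟩ with hκ
  set M := (Matrix.of fun a b : Fin n =>
    if (a : ℕ) < k then C (Y a b) else (X b : MvPolynomial (Fin n) R)) with hM
  set M' := (Matrix.of fun a b : Fin n =>
    if (a : ℕ) < k + 1 then C (Y a b) else (X b : MvPolynomial (Fin n) R)) with hM'
  -- right-hand side: row swaps and row expansion
  have hR : ∀ a ∈ univ.filter (fun a : Fin n => k ≤ (a : ℕ)),
      M'.permanent = (M.updateRow a fun b => C (Y κ b)).permanent := by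
    intro a ha
    rw [← Matrix.permanent_permute_cols (Equiv.swap κ a) M', hM', hM,
      rowMatrix_succ_submatrix_swap Y hk a (mem_filter.1 ha).2]
  rw [Finset.sum_congr rfl hR]
  simp only [permanent_updateRow_eq_sum]
  rw [Finset.sum_comm]
  -- left-hand side: Leibniz rule, and the derivative of an entry
  have hL : ∀ j, pderiv j M.permanent = ∑ σ : Equiv.Perm (Fin n), ∑ b,
      (∏ b' ∈ univ.erase b, M (σ b') b') * pderiv j (M (σ b) b) :=
    fun j => derivation_permanent _ _
  have hE : ∀ a b, (∑ j, C (Y κ j) * pderiv j (M a b)) = if (a : ℕ) < k then 0 else C (Y κ b) := by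
    intro a b
    simp only [hM, Matrix.of_apply]
    split_ifs with h
    · simp
    · have hXb : ∀ j : Fin n, pderiv j (X b : MvPolynomial (Fin n) R) = if j = b then 1 else 0 :=
        fun j => by rw [pderiv_X]; simp [Pi.single_apply, eq_comm]
      simp only [hXb, mul_ite, mul_one, mul_zero, Finset.sum_ite_eq', Finset.mem_univ, if_true]
  have hL' : (∑ j, C (Y κ j) * pderiv j M.permanent) = ∑ j, ∑ σ : Equiv.Perm (Fin n), ∑ b,
      C (Y κ j) * ((∏ b' ∈ univ.erase b, M (σ b') b') * pderiv j (M (σ b) b)) :=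
    Finset.sum_congr rfl fun j _ => by rw [hL j, Finset.mul_sum]; simp only [Finset.mul_sum]
  rw [hL', Finset.sum_comm]
  refine Finset.sum_congr rfl fun σ _ => ?_
  rw [Finset.sum_comm]
  have hinner : ∀ b,
      (∑ j, C (Y κ j) * ((∏ b' ∈ univ.erase b, M (σ b') b') * pderiv j (M (σ b) b))) =
      (∏ b' ∈ univ.erase b, M (σ b') b') * if ((σ b : Fin n) : ℕ) < k then 0 else C (Y κ b) := by
    intro b
    rw [← hE, Finset.mul_sum]
    exact Finset.sum_congr rfl fun j _ => by ring
  simp only [hinner]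
  -- reindex the right-hand side by `σ`
  rw [Finset.sum_filter]
  symm
  rw [← Equiv.sum_comp σ]
  refine Finset.sum_congr rfl fun b _ => ?_
  simp only [Equiv.symm_apply_apply]
  by_cases h : ((σ b : Fin n) : ℕ) < k
  · rw [if_neg (not_le.2 h), if_pos h, mul_zero]
  · rw [if_pos (not_lt.1 h), if_neg h, mul_comm]

/-- Beyond `n` constant rows nothing changes: for `n ≤ k` the `(k+1)`-row and `k`-row matrices
coincide (every row index is `< k`). -/
theorem rowMatrix_succ_of_le (Y : Fin n → Fin n → R) {k : ℕ} (hk : n ≤ k) :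
    (Matrix.of fun a b : Fin n =>
        if (a : ℕ) < k + 1 then C (Y a b) else (X b : MvPolynomial (Fin n) R)) =
      Matrix.of fun a b : Fin n =>
        if (a : ℕ) < k then C (Y a b) else (X b : MvPolynomial (Fin n) R) := by
  refine Matrix.ext fun a b => ?_
  have h1 : (a : ℕ) < k := lt_of_lt_of_le a.isLt hk
  rw [Matrix.of_apply, Matrix.of_apply, if_pos (Nat.lt_succ_of_lt h1), if_pos h1]

end Rows

/-! ### Nonnegative directional derivatives preserve stability -/

section Directional

variable {σ : Type*} [Fintype σ] [DecidableEq σ]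

/-- Chain rule along the lift `s_j ↦ s_j + y_j t` (`t` the new variable `none`):
`∂_t p(s + t y) = (Σ_j y_j ∂_j p)(s + t y)`. -/
theorem pderiv_none_bind₁_lineLift (y : σ → ℂ) (p : MvPolynomial σ ℂ) :
    pderiv none (bind₁ (fun j => X (some j) + C (y j) * X none : σ → MvPolynomial (Option σ) ℂ) p) =
      bind₁ (fun j => X (some j) + C (y j) * X none : σ → MvPolynomial (Option σ) ℂ)
        (∑ j, C (y j) * pderiv j p) := by
  induction p using MvPolynomial.induction_on with
  | C a => simp
  | add p q hp hq =>
    simp only [map_add, hp, hq, mul_add, Finset.sum_add_distrib]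
  | mul_X p i hp =>
    have hXi : ∀ j : σ, pderiv j (X i : MvPolynomial σ ℂ) = if j = i then 1 else 0 := fun j => by
      rw [pderiv_X]; simp [Pi.single_apply, eq_comm]
    have hsum : (∑ j, C (y j) * pderiv j (p * X i)) =
        (∑ j, C (y j) * pderiv j p) * X i + p * C (y i) := by
      simp only [pderiv_mul, hXi, mul_add, Finset.sum_add_distrib, Finset.sum_mul, mul_ite, mul_one,
        mul_zero, Finset.sum_ite_eq', Finset.mem_univ, if_true]
      congr 1
      · exact Finset.sum_congr rfl fun j _ => by ring
      · ring
    rw [hsum, map_mul, pderiv_mul, hp, map_add, map_mul, map_mul, bind₁_X_right, bind₁_C_right]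
    have hd : pderiv none (X (some i) + C (y i) * X none : MvPolynomial (Option σ) ℂ) = C (y i) := by
      rw [map_add, pderiv_C_mul, pderiv_X_self, pderiv_X_of_ne (by simp), zero_add, mul_one]
    rw [hd]

/-- **Nonnegative directional derivatives preserve stability** (Lieb–Sokal; Borcea–Brändén 2009,
Lemma 2.1 / Wagner 2011, Lemma 2.4 (d),(f)): if `p` is stable and `y ∈ ℝ^σ` has nonnegative
entries then `Σ_j y_j ∂_j p` is `0` or stable. Proof: the lift `p̃(s, t) = p(s + t y)` is stable
in the variables `Option σ` (`s + ty ∈ H^σ` for `(s, t) ∈ H^{σ+1}` as `y ≥ 0`);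
`∂_t p̃ = (Σ_j y_j ∂_j p)~` (`pderiv_none_bind₁_lineLift`) is `0` or stable
(`IsUpperHalfPlaneStable.pderiv`), and so is its specialisation at `t = 0`
(`eq_zero_or_stable_of_eval_update_zero`), which is `Σ_j y_j ∂_j p` in the variables `some`. -/
theorem zero_or_isUpperHalfPlaneStable_sum_C_mul_pderiv {p : MvPolynomial σ ℂ}
    (hp : IsUpperHalfPlaneStable p) {y : σ → ℝ} (hy : ∀ j, 0 ≤ y j) :
    (∑ j, C ((y j : ℝ) : ℂ) * pderiv j p) = 0 ∨
      IsUpperHalfPlaneStable (∑ j, C ((y j : ℝ) : ℂ) * pderiv j p) := by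
  set D := ∑ j, C ((y j : ℝ) : ℂ) * pderiv j p with hD
  let f : σ → MvPolynomial (Option σ) ℂ := fun j => X (some j) + C ((y j : ℝ) : ℂ) * X none
  have hf : ∀ (z : Option σ → ℂ) j, eval z (f j) = z (some j) + (y j : ℂ) * z none := fun z j => by
    simp [f]
  -- the lift `p̃(z, t) = p(z + t y)` is stable
  have hpt : IsUpperHalfPlaneStable (bind₁ f p) := by
    intro z hz
    rw [eval_bind₁]
    refine hp _ fun j => ?_
    rw [hf]
    simp only [Complex.add_im, Complex.mul_im, Complex.ofReal_re, Complex.ofReal_im, zero_mul,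
      add_zero]
    exact add_pos_of_pos_of_nonneg (hz _) (mul_nonneg (hy j) (hz none).le)
  -- `∂_t p̃ = (D_y p)~` is `0` or stable
  have hder : pderiv none (bind₁ f p) = bind₁ f D := pderiv_none_bind₁_lineLift _ p
  have hG : bind₁ f D = 0 ∨ IsUpperHalfPlaneStable (bind₁ f D) := hder ▸ hpt.pderiv none
  -- specialise `t := 0`: the result is `rename some D`
  have hA : rename some D = 0 ∨ IsUpperHalfPlaneStable (rename some D) := by
    refine eq_zero_or_stable_of_eval_update_zero none hG fun z => ?_
    rw [eval_bind₁, eval_rename]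
    have hfun : (fun j => eval (Function.update z none 0) (f j)) = z ∘ some := by
      funext j
      rw [hf]
      simp
    rw [hfun]
  rcases hA with h0 | hst
  · left
    exact rename_injective _ (Option.some_injective _) (by rw [h0, map_zero])
  · right
    intro w hw
    have := hst (fun o => Option.elim o Complex.I w) fun o => by
      cases o with
      | none => simp
      | some j => simpa using hw j
    rwa [eval_rename] at this

end Directional

/-! ### Stability of the permanental polynomials and the route item -/

section Stable

variable {n : ℕ}

/-- Base case: with no constant row, `per[s; …; s] = n! ∏_j s_j` has no zero in `Hⁿ`. -/
theorem isUpperHalfPlaneStable_rowPermanent_zero (Y : Fin n → Fin n → ℂ) :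
    IsUpperHalfPlaneStable (Matrix.of fun a b : Fin n =>
      if (a : ℕ) < 0 then C (Y a b) else (X b : MvPolynomial (Fin n) ℂ)).permanent := by
  intro z hz
  rw [ringHom_map_permanent (eval z)]
  have hM : (Matrix.of fun a b : Fin n =>
      if (a : ℕ) < 0 then C (Y a b) else (X b : MvPolynomial (Fin n) ℂ)).map (eval z) =
      Matrix.of fun _ b => z b := by
    ext a b
    simp
  rw [hM]
  simp only [Matrix.permanent, Matrix.of_apply, Finset.sum_const, Finset.card_univ, nsmul_eq_mul]
  refine mul_ne_zero (Nat.cast_ne_zero.2 Fintype.card_ne_zero) ?_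
  exact Finset.prod_ne_zero_iff.2 fun b _ h => by simpa [h] using hz b

/-- **The permanental polynomials are `0` or stable**: for real `Y ≥ 0` entrywise and every `k`,
the complex polynomial `per[Y_{rows<k}; s; …; s]` is `0` or has no zero in `Hⁿ` — induction on
`k` through the row recursion `sum_C_mul_pderiv_rowPermanent` and
`zero_or_isUpperHalfPlaneStable_sum_C_mul_pderiv`. -/
theorem rowPermanent_zero_or_isUpperHalfPlaneStable (Y : Fin n → Fin n → ℝ)
    (hY : ∀ i j, 0 ≤ Y i j) (k : ℕ) :
    (Matrix.of fun a b : Fin n =>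
        if (a : ℕ) < k then C ((Y a b : ℝ) : ℂ) else (X b : MvPolynomial (Fin n) ℂ)).permanent = 0 ∨
      IsUpperHalfPlaneStable (Matrix.of fun a b : Fin n =>
        if (a : ℕ) < k then C ((Y a b : ℝ) : ℂ) else (X b : MvPolynomial (Fin n) ℂ)).permanent := by
  induction k with
  | zero => exact Or.inr (isUpperHalfPlaneStable_rowPermanent_zero _)
  | succ k ih =>
    by_cases hk : k < n
    · have hrec := sum_C_mul_pderiv_rowPermanent (fun a b => ((Y a b : ℝ) : ℂ)) hk
      rw [Finset.sum_const, nsmul_eq_mul] at hrec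
      set c : ℕ := (univ.filter fun a : Fin n => k ≤ (a : ℕ)).card with hc
      have hc0 : c ≠ 0 := by
        rw [hc, ← pos_iff_ne_zero, Finset.card_pos]
        exact ⟨⟨k, hk⟩, by simp⟩
      have hD := ih.elim (fun h0 => Or.inl (by simp [h0]) :
          _ → (∑ j, C ((Y ⟨k, hk⟩ j : ℝ) : ℂ) * pderiv j (Matrix.of fun a b : Fin n =>
            if (a : ℕ) < k then C ((Y a b : ℝ) : ℂ) else (X b : MvPolynomial (Fin n) ℂ)).permanent) = 0 ∨
            IsUpperHalfPlaneStable (∑ j, C ((Y ⟨k, hk⟩ j : ℝ) : ℂ) * pderiv j (Matrix.of fun a b : Fin n =>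
            if (a : ℕ) < k then C ((Y a b : ℝ) : ℂ) else (X b : MvPolynomial (Fin n) ℂ)).permanent))
        (fun hst => zero_or_isUpperHalfPlaneStable_sum_C_mul_pderiv hst fun j => hY ⟨k, hk⟩ j)
      rw [hrec] at hD
      have hcC : ((c : ℕ) : MvPolynomial (Fin n) ℂ) = C (c : ℂ) := (map_natCast C c).symm
      rcases hD with h0 | hst
      · left
        refine (mul_eq_zero.1 h0).resolve_left ?_
        rw [hcC, C_eq_zero, Nat.cast_eq_zero]
        exact hc0
      · right
        have hc0' : (c : ℂ) ≠ 0 := Nat.cast_ne_zero.2 hc0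
        have key := (isUpperHalfPlaneStable_C (σ := Fin n) (inv_ne_zero hc0')).mul hst
        rwa [hcC, ← mul_assoc, ← map_mul, inv_mul_cancel₀ hc0', map_one, one_mul] at key
    · rw [rowMatrix_succ_of_le _ (not_lt.1 hk)]
      exact ih

/-- **Item `PermanentalHyperbolic` of route `PermanentalCones`** (Gårding/Lieb–Sokal for the
witnesses): for entrywise nonnegative `Y`, `P = per[Y_{rows<r}; s^{(n-r)}]` is real stable, hence
if `P(𝟙) ≠ 0` every zero `z` of `z ↦ P(x + z𝟙)` (`x ∈ ℝⁿ`) is real: a zero with `Im z > 0` would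
put `x + z𝟙` in `Hⁿ`, one with `Im z < 0` would after conjugation (real coefficients). -/
theorem permanentalHyperbolic_proof :
    Summit.ValiantsHypothesis.ValiantsHypothesis.Theses.PermanentalCones.PermanentalHyperbolic := by
  unfold Summit.ValiantsHypothesis.ValiantsHypothesis.Theses.PermanentalCones.PermanentalHyperbolic
  intro n r Y hY P hP h1 x z hz
  -- the complexification of `P` is the permanental polynomial with complexified constants
  have hmap : MvPolynomial.map (algebraMap ℝ ℂ) P = (Matrix.of fun a b : Fin n =>
      if (a : ℕ) < r then C ((Y a b : ℝ) : ℂ) else (X b : MvPolynomial (Fin n) ℂ)).permanent := by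
    rw [hP, ringHom_map_permanent (MvPolynomial.map (algebraMap ℝ ℂ))]
    congr 1
    ext a b
    simp only [Matrix.map_apply, Matrix.of_apply]
    split_ifs <;> simp
  have hst : IsRealStable P := by
    rcases rowPermanent_zero_or_isUpperHalfPlaneStable (fun a b => Y a b) hY r with h0 | h
    · exfalso
      apply h1
      have hP0 : P = 0 :=
        map_injective _ (algebraMap ℝ ℂ).injective (by rw [hmap.trans h0, map_zero])
      rw [hP0, map_zero]
    · show IsUpperHalfPlaneStable _
      rw [hmap]
      exact h
  refine hst.im_eq_zero_of_eval₂_line_eq_zero x (b := fun _ => (1 : ℝ)) (fun _ => one_pos) ?_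
  rw [← eval_map]
  have hfun : (fun i => ((x i : ℝ) : ℂ) + z * (((fun _ => (1 : ℝ)) i : ℝ) : ℂ)) =
      fun j => ((x j : ℝ) : ℂ) + z := by
    funext j
    simp
  rw [hfun]
  exact hz

end Stable

end Summit.ValiantsHypothesis.ValiantsHypothesis.Theorems

end
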